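import Mathlib
import HarnessLib
import Summits.NavierStokesRegularity.NavierStokesRegularity.Theses.UnthreadedRigidityDoor
import Summits.NavierStokesRegularity.NavierStokesRegularity.Theorems.UnthreadedRigidityDoorUnthreadedRigidityVirialHornWindowRung
import Summits.NavierStokesRegularity.NavierStokesRegularity.Theorems.UnthreadedRigidityDoorUnthreadedRigidityVirialHornWindowAxisUniform
import Summits.NavierStokesRegularity.NavierStokesRegularity.Theorems.UnthreadedRigidityDoorUnthreadedRigidityVirialHornZonal
import Summits.NavierStokesRegularity.NavierStokesRegularity.Theorems.UnthreadedRigidityDoorUnthreadedRigidityCoZonalDefs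
import Summits.NavierStokesRegularity.NavierStokesRegularity.Theorems.UnthreadedRigidityDoorUnthreadedRigidityVirialHornOrderTwoLaw

/-!
# Route `UnthreadedRigidityDoor`, item `UnthreadedRigidity` (W2, stmt-NavierStokesRegularity-27585) — LINE g12-1 «CO-ZONAL DICHOTOMY»:
# the kernel-checked COMPOSITIONS BY NAME (Theorems-side twin of the sketch's theorems)

Prover file (engine-1 g71, KEY-NS #205; `--supports stmt-NavierStokesRegularity-27585 --as helper`); VERBATIM from `CoZonal_sketch.lean`
(c7eabdeb25f1685c): `twoShellWindowRigidity_of_crux`, `linkedPairWindowRigidity_of_crux` (the rungs ARE restrictions of 27585), `pbr_swap` (`pbr_apply_zero` is ns-crc-p2's, imported),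
`poissonCommute_symm`, `twoShellSliceOrderOneLaw_of_identity` (O1₂ + homogeneity ⇒ dichotomy form), `coZonalLemma_of_supports` (S-C ∧ CZ-a ∧ CZ-b ⇒ CZ),
`twoShellWindowRigidity_of_bridges`, `twoShellSliceDichotomy_of_bridges`, `twoShellSliceDichotomyAll_of_bridges`, `twoShellWindowRigidityAll_of_bridges`.

HONEST LABEL: plumbing of a RUNG line about SPECIAL two-shell data; `UnthreadedRigidity` (27585), W2 and NS regularity remain OPEN; nothing here is a
statement about the Navier–Stokes equations; nobody here claims `UnthreadedRigidity`.  0 kit.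
-/

-- the summit and its single sub-problem share the name (CONVENTIONS §1), as in every Theorems file
set_option linter.dupNamespace false

namespace Summit.NavierStokesRegularity.NavierStokesRegularity.Theorems.UnthreadedRigidity.CoZonal

open Summit.NavierStokesRegularity.NavierStokesRegularity.Theorems.UnthreadedRigidity.VirialHorn
open Summit.NavierStokesRegularity.NavierStokesRegularity.Theorems.UnthreadedRigidity.ProfileHorn (E3 IsSliceAxisymmetric)
open Summit.NavierStokesRegularity.NavierStokesRegularity.Theorems.UnthreadedRigidity.ThreadingJets (fluxJetOne)

/-- THE RUNG IS A RESTRICTION OF THE CRUX (kernel-checked): `UnthreadedRigidity → TwoShellWindowRigidity l₁ l₂`. -/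
theorem twoShellWindowRigidity_of_crux (l₁ l₂ : ℕ)
    (h : Summit.NavierStokesRegularity.NavierStokesRegularity.Theses.UnthreadedRigidityDoor.UnthreadedRigidity) :
    TwoShellWindowRigidity l₁ l₂ := by
  intro S hS hconn u x₀ hcont hdiv hmild hbdd hunth Y₁ Y₂ H₁f H₂f _ _ _ _ _ _ _
  exact h S hS hconn u x₀ hcont hdiv hmild hbdd hunth

/-- so does the residual follow from the crux (it is a further restriction). -/
theorem linkedPairWindowRigidity_of_crux (l₁ l₂ : ℕ)
    (h : Summit.NavierStokesRegularity.NavierStokesRegularity.Theses.UnthreadedRigidityDoor.UnthreadedRigidity) :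
    LinkedPairWindowRigidity l₁ l₂ := by
  intro S hS hconn u x₀ hcont hdiv hmild hbdd hunth Y₁ Y₂ H₁f H₂f _ _ _ _ _ _ _ _ _
  exact h S hS hconn u x₀ hcont hdiv hmild hbdd hunth

/-- `{g,f} = −{f,g}`. -/
theorem pbr_swap (f g : E3 → ℝ) (y : E3) : pbr g f y = - pbr f g y := by
  simp only [pbr, det3]
  ring

/-- Poisson-commutation is symmetric. -/
theorem poissonCommute_symm {Y₁ Y₂ : E3 → ℝ} (h : PoissonCommute Y₁ Y₂) : PoissonCommute Y₂ Y₁ := by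
  intro y
  rw [pbr_swap, h y, neg_zero]

/-- BRIDGE O1₂: identity + homogeneity ⇒ the dichotomy (kernel-checked, elementary). -/
theorem twoShellSliceOrderOneLaw_of_identity (hI : TwoShellSliceOrderOneIdentity) (hP : PbrHomogeneous) :
    TwoShellSliceOrderOneLaw := by
  intro l₁ l₂ H₁ H₂ Y₁ Y₂ x₀ hl₁ hl₂ hY₁ hY₂ hH₁ hH₂ hflux
  by_cases hc : PoissonCommute Y₁ Y₂
  · exact Or.inl hc
  · right
    simp only [PoissonCommute, not_forall] at hc
    obtain ⟨y₀, hy₀⟩ := hc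
    have hy₀ne : y₀ ≠ 0 := by
      rintro rfl
      exact hy₀ (pbr_apply_zero Y₁ Y₂)
    have hn : 0 < ‖y₀‖ := norm_pos_iff.mpr hy₀ne
    intro r hr
    set c : ℝ := r / ‖y₀‖ with hc_def
    have hcpos : 0 < c := div_pos hr hn
    have hnorm : ‖c • y₀‖ = r := by
      rw [norm_smul, Real.norm_eq_abs, abs_of_pos hcpos, hc_def, div_mul_cancel₀ r hn.ne']
    have hid := hI l₁ l₂ H₁ H₂ Y₁ Y₂ x₀ hl₁ hl₂ hY₁ hY₂ hH₁ hH₂ (c • y₀) (smul_ne_zero hcpos.ne' hy₀ne)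
    rw [hflux (x₀ + c • y₀), hnorm, hP l₁ l₂ Y₁ Y₂ hl₁ hl₂ hY₁ hY₂ c y₀ hcpos] at hid
    have hpow : c ^ (l₁ + l₂ - 1) * pbr Y₁ Y₂ y₀ ≠ 0 := mul_ne_zero (pow_ne_zero _ hcpos.ne') hy₀
    rcases mul_eq_zero.mp hid.symm with h | h
    · exact h
    · exact absurd h hpow

/-- CZ from its two steps and S-C (kernel-checked composition; `AngularLemma` is VirialHorn's S-C, proved in tree for `l ≤ 2`). -/
theorem coZonalLemma_of_supports (hC : AngularLemma) (hA : CommutingAngularSilence) (hM : ZonalAxesMatch) :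
    CoZonalLemma := by
  intro l₁ l₂ Y₁ Y₂ hl₁ hl₂ hne hY₁ hY₂ hY₁ne hY₂ne hcomm
  -- angular silence of both harmonics
  have hang₁ : ∀ y, angForm Y₁ y = 0 := hA l₁ l₂ Y₁ Y₂ hl₁ hl₂ hne hY₁ hY₂ hY₂ne hcomm
  have hang₂ : ∀ y, angForm Y₂ y = 0 :=
    hA l₂ l₁ Y₂ Y₁ hl₂ hl₁ (Ne.symm hne) hY₂ hY₁ hY₁ne (poissonCommute_symm hcomm)
  -- S-C: both are zonal
  obtain ⟨a, ha, hZa⟩ := hC l₁ Y₁ hY₁ hang₁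
  obtain ⟨b, hb, hZb⟩ := hC l₂ Y₂ hY₂ hang₂
  -- axes match
  exact ⟨a, ha, hZa, hM l₁ l₂ Y₁ Y₂ a b hl₁ hl₂ hY₁ hY₂ hY₁ne hY₂ne ha hb hZa hZb hcomm⟩

/-- ★ THE WINDOW RUNG FROM THE BRIDGES (kernel-checked; every degree pair `l₁ ≠ l₂`, both `≥ 1`):
O1-window-silence (M) + O1₂-law (L) + CZ (S–M) + Z⁺ (S) + the residual R + S-U (tree, `windowAxisUniform_holds`) ⇒ `TwoShellWindowRigidity l₁ l₂`.
The dichotomy is GLOBAL IN TIME: `{Y₁,Y₂}` does not depend on `t`. -/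
theorem twoShellWindowRigidity_of_bridges (l₁ l₂ : ℕ) (hl₁ : 1 ≤ l₁) (hl₂ : 1 ≤ l₂) (hne : l₁ ≠ l₂)
    (hW : WindowOrderOneSilence) (hL : TwoShellSliceOrderOneLaw) (hCZ : CoZonalLemma) (hAx : CoZonalShellAxisym)
    (hR : LinkedPairWindowRigidity l₁ l₂) :
    TwoShellWindowRigidity l₁ l₂ := by
  intro S hS hconn u x₀ hcont hdiv hmild hbdd hunth Y₁ Y₂ H₁f H₂f hY₁ hY₂ hY₁ne hY₂ne hH₁ hH₂ hshape
  by_cases hc : IsCoZonal Y₁ Y₂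
  · -- co-zonal: every slice is axisymmetric about the common axis; S-U transports one generator across the window
    have hslice : ∀ t ∈ S, IsSliceAxisymmetric (u t) x₀ := by
      intro t ht
      rw [hshape t ht]
      exact hAx l₁ l₂ (H₁f t) (H₂f t) Y₁ Y₂ x₀ hY₁ hY₂ (hH₁ t ht) (hH₂ t ht) hc
    exact windowAxisUniform_holds S hS hconn u x₀ hcont hdiv hmild hbdd hslice
  · -- not co-zonal: by CZ the angular parts do not Poisson-commute, so order one LINKS the profiles at every time
    have hncomm : ¬ PoissonCommute Y₁ Y₂ := fun h => hc (hCZ l₁ l₂ Y₁ Y₂ hl₁ hl₂ hne hY₁ hY₂ hY₁ne hY₂ne h)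
    have hlinked : ∀ t ∈ S, IsLinkedPair l₁ l₂ (H₁f t) (H₂f t) := by
      intro t ht
      have hflux : ∀ x, fluxJetOne (twoShellL (H₁f t) (H₂f t) Y₁ Y₂ x₀) x₀ x = 0 := by
        intro x
        rw [← hshape t ht]
        exact hW S hS u x₀ hcont hdiv hmild hbdd hunth t ht x
      rcases hL l₁ l₂ (H₁f t) (H₂f t) Y₁ Y₂ x₀ hl₁ hl₂ hY₁ hY₂ (hH₁ t ht) (hH₂ t ht) hflux with h | h
      · exact absurd h hncomm
      · exact h
    exact hR S hS hconn u x₀ hcont hdiv hmild hbdd hunth Y₁ Y₂ H₁f H₂f hY₁ hY₂ hY₁ne hY₂ne hc hH₁ hH₂ hshape hlinked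

/-- ★ the slice dichotomy from O1₂-law + CZ + Z⁺ (kernel-checked; every `l₁ ≠ l₂`, both `≥ 1`). -/
theorem twoShellSliceDichotomy_of_bridges (l₁ l₂ : ℕ) (hl₁ : 1 ≤ l₁) (hl₂ : 1 ≤ l₂) (hne : l₁ ≠ l₂)
    (hL : TwoShellSliceOrderOneLaw) (hCZ : CoZonalLemma) (hAx : CoZonalShellAxisym) :
    TwoShellSliceDichotomy l₁ l₂ := by
  intro H₁ H₂ Y₁ Y₂ x₀ hY₁ hY₂ hY₁ne hY₂ne hH₁ hH₂ hflux
  rcases hL l₁ l₂ H₁ H₂ Y₁ Y₂ x₀ hl₁ hl₂ hY₁ hY₂ hH₁ hH₂ hflux with h | h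
  · exact Or.inl (hAx l₁ l₂ H₁ H₂ Y₁ Y₂ x₀ hY₁ hY₂ hH₁ hH₂ (hCZ l₁ l₂ Y₁ Y₂ hl₁ hl₂ hne hY₁ hY₂ hY₁ne hY₂ne h))
  · exact Or.inr h

/-- the slice dichotomy in all degree pairs, from the bridges. -/
theorem twoShellSliceDichotomyAll_of_bridges
    (hL : TwoShellSliceOrderOneLaw) (hCZ : CoZonalLemma) (hAx : CoZonalShellAxisym) : TwoShellSliceDichotomyAll :=
  fun l₁ l₂ hl₁ hl₂ hne => twoShellSliceDichotomy_of_bridges l₁ l₂ hl₁ hl₂ hne hL hCZ hAx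

/-- all degree pairs: the two-shell window rung waits on the four obligations and the residual family. -/
theorem twoShellWindowRigidityAll_of_bridges
    (hW : WindowOrderOneSilence) (hL : TwoShellSliceOrderOneLaw) (hCZ : CoZonalLemma) (hAx : CoZonalShellAxisym)
    (hR : LinkedPairWindowRigidityAll) : TwoShellWindowRigidityAll :=
  fun l₁ l₂ hl₁ hl₂ hne =>
    twoShellWindowRigidity_of_bridges l₁ l₂ hl₁ hl₂ hne hW hL hCZ hAx (hR l₁ l₂ hl₁ hl₂ hne)

end Summit.NavierStokesRegularity.NavierStokesRegularity.Theorems.UnthreadedRigidity.CoZonal
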